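import Summits.NavierStokesRegularity.NavierStokesRegularity.Theorems.ExtremiserTransienceNearExtremalTransienceExtremiserLiouvilleTruncationProfile
import HarnessLib

/-!
# Crux `ExtremiserTransience.NearExtremalTransience` (stmt-NavierStokesRegularity-21883), line `extremiser_liouville`,
# stub K1b — DENSITY LEAF, part 3b: POINTWISE BOUNDS OF ORDERS 0, 1, 2 FOR THE SOLENOIDAL TRUNCATION ERROR

`--supports stmt-NavierStokesRegularity-21883` (helper).  Author: prover seat `ns-el-k1b` (g2).

For the tree's explicit divergence-free truncation `Ψ_R = solenoidalTruncation V R`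
(`Literature/Analysis/FluidPDE/SolenoidalTruncation.lean`; `Ψ_R = χ_R V + Dχ_R(x) F − Dχ_R(F) x`, `F = poincareField V`)
this file proves the pointwise bounds of the error `Ψ_R − V` and of its first and SECOND derivatives that the
palinstrophy estimate of the density leaf needs, in the scale-invariant form with annulus indicators:

* `norm_iteratedFDeriv_cutoffSub_smul_le_one/_two` — Leibniz bounds for the cut-off term `(χ(x/R) − 1)V(x)`;
* `exists_truncation_error_bounds` — **the bounds**: there is `K` (depending only on the cut-off profile) such that
  for every `C²` field `V`, every `R ≥ 1` and every `x`, with `A_R = {R ≤ ‖x‖ ≤ 2R}`,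
  `‖D(Ψ_R − V)(x)‖ ≤ 𝟙_{R≤‖x‖}‖DV(x)‖ + 𝟙_{A_R}(x)·K·(R⁻¹‖V(x)‖ + ‖DF(x)‖ + R⁻¹‖F(x)‖)` and
  `‖D²(Ψ_R − V)(x)‖ ≤ 𝟙_{R≤‖x‖}‖D²V(x)‖ + 𝟙_{A_R}(x)·K·(‖DV(x)‖ + R⁻¹‖V(x)‖ + ‖D²F(x)‖ + ‖DF(x)‖ + R⁻¹‖F(x)‖)`
  (`Dⁿ = iteratedFDeriv ℝ n`), together with the order-zero bound `‖Ψ_R(x) − χ_R(x)V(x)‖ ≤ K 𝟙_{A_R}(x)‖F(x)‖`.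

WHAT THIS IS NOT: nothing here is about Navier–Stokes solutions; the crux NET, rung N0 and NS regularity stay
OPEN — nothing here proves NS regularity. [folklore]
-/

noncomputable section

open Set Filter Topology MeasureTheory Metric Function
open scoped ENNReal NNReal Topology
open Literature.Analysis.FluidPDE Literature.Analysis

namespace Summit.NavierStokesRegularity.NavierStokesRegularity.Theorems

-- the problem directory repeats the summit name (`NavierStokesRegularity/NavierStokesRegularity`)
set_option linter.dupNamespace false

namespace ExtremiserLiouville

/-! ## Leibniz bounds for the cut-off term `(χ(x/R) − 1) V(x)` -/

section CutoffTerm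

/-- **First-order bound for `(χ(·/R) − 1)·g`**: with `|χ − 1| ≤ 1` and `‖Dχ‖ ≤ b`,
`‖D((χ(·/R) − 1) g)(x)‖ ≤ ‖Dg(x)‖ + (b/R)‖g(x)‖`. [folklore] -/
theorem norm_iteratedFDeriv_cutoffSub_smul_le_one {χ : EuclideanSpace ℝ (Fin 3) → ℝ} (hχ : ContDiff ℝ 1 χ) {b : ℝ}
    (h0 : ∀ y, |χ y - 1| ≤ 1) (h1 : ∀ y, ‖iteratedFDeriv ℝ 1 χ y‖ ≤ b)
    {g : EuclideanSpace ℝ (Fin 3) → EuclideanSpace ℝ (Fin 3)} (hg : ContDiff ℝ 1 g) {R : ℝ} (hR : 0 < R)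
    (x : EuclideanSpace ℝ (Fin 3)) :
    ‖iteratedFDeriv ℝ 1 (fun x => (χ (R⁻¹ • x) - 1) • g x) x‖ ≤ ‖iteratedFDeriv ℝ 1 g x‖ + b / R * ‖g x‖ := by
  have hsR : ContDiff ℝ 1 (fun x : EuclideanSpace ℝ (Fin 3) => χ (R⁻¹ • x) - 1) :=
    (hχ.comp (contDiff_const_smul _)).sub contDiff_const
  have h := norm_iteratedFDeriv_smul_le (n := 1) hsR hg x (by norm_num)
  have h' : ‖iteratedFDeriv ℝ 1 (fun x => (χ (R⁻¹ • x) - 1) • g x) x‖ ≤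
      ‖iteratedFDeriv ℝ 0 (fun x : EuclideanSpace ℝ (Fin 3) => χ (R⁻¹ • x) - 1) x‖ * ‖iteratedFDeriv ℝ 1 g x‖ +
        ‖iteratedFDeriv ℝ 1 (fun x : EuclideanSpace ℝ (Fin 3) => χ (R⁻¹ • x) - 1) x‖ * ‖iteratedFDeriv ℝ 0 g x‖ := by
    simp only [Finset.sum_range_succ, Finset.sum_range_zero, zero_add, Nat.choose_zero_right, Nat.cast_one,
      one_mul, Nat.choose_self, Nat.sub_zero] at h
    exact h
  refine h'.trans ?_
  rw [norm_iteratedFDeriv_zero, norm_iteratedFDeriv_zero]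
  -- the derivative does not see the constant
  have hsub : iteratedFDeriv ℝ 1 (fun x : EuclideanSpace ℝ (Fin 3) => χ (R⁻¹ • x) - 1) x =
      iteratedFDeriv ℝ 1 (fun x : EuclideanSpace ℝ (Fin 3) => χ (R⁻¹ • x)) x := by
    have e : (fun x : EuclideanSpace ℝ (Fin 3) => χ (R⁻¹ • x) - 1) =
        (fun x : EuclideanSpace ℝ (Fin 3) => χ (R⁻¹ • x)) - fun _ => (1 : ℝ) := rfl
    have hc : ContDiff ℝ 1 (fun x : EuclideanSpace ℝ (Fin 3) => χ (R⁻¹ • x)) := hχ.comp (contDiff_const_smul _)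
    rw [e, iteratedFDeriv_sub_apply hc.contDiffAt contDiffAt_const,
      iteratedFDeriv_const_of_ne (by norm_num), Pi.zero_apply, sub_zero]
  have e0 : ‖χ (R⁻¹ • x) - 1‖ ≤ 1 := by rw [Real.norm_eq_abs]; exact h0 _
  have e1 : ‖iteratedFDeriv ℝ 1 (fun x : EuclideanSpace ℝ (Fin 3) => χ (R⁻¹ • x) - 1) x‖ ≤ b / R := by
    rw [hsub]
    refine (norm_iteratedFDeriv_comp_smul_le hχ hR le_rfl x).trans ?_
    rw [pow_one, div_eq_inv_mul]
    gcongr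
    exact h1 _
  have hb : 0 ≤ b / R := le_trans (norm_nonneg _) e1
  calc ‖χ (R⁻¹ • x) - 1‖ * ‖iteratedFDeriv ℝ 1 g x‖ +
        ‖iteratedFDeriv ℝ 1 (fun x : EuclideanSpace ℝ (Fin 3) => χ (R⁻¹ • x) - 1) x‖ * ‖g x‖
      ≤ 1 * ‖iteratedFDeriv ℝ 1 g x‖ + b / R * ‖g x‖ := by gcongr
    _ = ‖iteratedFDeriv ℝ 1 g x‖ + b / R * ‖g x‖ := by rw [one_mul]

/-- **Second-order bound for `(χ(·/R) − 1)·g`**: with `|χ − 1| ≤ 1`, `‖Dχ‖, ‖D²χ‖ ≤ b`,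
`‖D²((χ(·/R) − 1) g)(x)‖ ≤ ‖D²g(x)‖ + (2b/R)‖Dg(x)‖ + (b/R²)‖g(x)‖`. [folklore] -/
theorem norm_iteratedFDeriv_cutoffSub_smul_le_two {χ : EuclideanSpace ℝ (Fin 3) → ℝ} (hχ : ContDiff ℝ 2 χ) {b : ℝ}
    (h0 : ∀ y, |χ y - 1| ≤ 1) (h1 : ∀ y, ‖iteratedFDeriv ℝ 1 χ y‖ ≤ b) (h2 : ∀ y, ‖iteratedFDeriv ℝ 2 χ y‖ ≤ b)
    {g : EuclideanSpace ℝ (Fin 3) → EuclideanSpace ℝ (Fin 3)} (hg : ContDiff ℝ 2 g) {R : ℝ} (hR : 0 < R)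
    (x : EuclideanSpace ℝ (Fin 3)) :
    ‖iteratedFDeriv ℝ 2 (fun x => (χ (R⁻¹ • x) - 1) • g x) x‖ ≤
      ‖iteratedFDeriv ℝ 2 g x‖ + 2 * (b / R) * ‖iteratedFDeriv ℝ 1 g x‖ + b / R ^ 2 * ‖g x‖ := by
  have hsR : ContDiff ℝ 2 (fun x : EuclideanSpace ℝ (Fin 3) => χ (R⁻¹ • x) - 1) :=
    (hχ.comp (contDiff_const_smul _)).sub contDiff_const
  have h := norm_iteratedFDeriv_smul_le (n := 2) hsR hg x (by norm_num)
  have h' : ‖iteratedFDeriv ℝ 2 (fun x => (χ (R⁻¹ • x) - 1) • g x) x‖ ≤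
      ‖iteratedFDeriv ℝ 0 (fun x : EuclideanSpace ℝ (Fin 3) => χ (R⁻¹ • x) - 1) x‖ * ‖iteratedFDeriv ℝ 2 g x‖ +
        2 * ‖iteratedFDeriv ℝ 1 (fun x : EuclideanSpace ℝ (Fin 3) => χ (R⁻¹ • x) - 1) x‖ * ‖iteratedFDeriv ℝ 1 g x‖ +
        ‖iteratedFDeriv ℝ 2 (fun x : EuclideanSpace ℝ (Fin 3) => χ (R⁻¹ • x) - 1) x‖ * ‖iteratedFDeriv ℝ 0 g x‖ := by
    simp only [Finset.sum_range_succ, Finset.sum_range_zero, zero_add, Nat.choose_zero_right, Nat.cast_one,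
      one_mul, Nat.choose_self, Nat.sub_zero, show Nat.choose 2 1 = 2 by rfl, Nat.cast_ofNat] at h
    exact h
  refine h'.trans ?_
  rw [norm_iteratedFDeriv_zero, norm_iteratedFDeriv_zero]
  have hsub : ∀ i : ℕ, 1 ≤ i → i ≤ 2 → iteratedFDeriv ℝ i (fun x : EuclideanSpace ℝ (Fin 3) => χ (R⁻¹ • x) - 1) x =
      iteratedFDeriv ℝ i (fun x : EuclideanSpace ℝ (Fin 3) => χ (R⁻¹ • x)) x := by
    intro i hi hi2
    have e : (fun x : EuclideanSpace ℝ (Fin 3) => χ (R⁻¹ • x) - 1) =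
        (fun x : EuclideanSpace ℝ (Fin 3) => χ (R⁻¹ • x)) - fun _ => (1 : ℝ) := rfl
    have hc : ContDiff ℝ i (fun x : EuclideanSpace ℝ (Fin 3) => χ (R⁻¹ • x)) :=
      (hχ.of_le (by exact_mod_cast hi2)).comp (contDiff_const_smul _)
    rw [e, iteratedFDeriv_sub_apply hc.contDiffAt contDiffAt_const, iteratedFDeriv_const_of_ne (by omega),
      Pi.zero_apply, sub_zero]
  have e0 : ‖χ (R⁻¹ • x) - 1‖ ≤ 1 := by rw [Real.norm_eq_abs]; exact h0 _
  have e1 : ‖iteratedFDeriv ℝ 1 (fun x : EuclideanSpace ℝ (Fin 3) => χ (R⁻¹ • x) - 1) x‖ ≤ b / R := by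
    rw [hsub 1 le_rfl (by norm_num)]
    refine (norm_iteratedFDeriv_comp_smul_le hχ hR (by norm_num) x).trans ?_
    rw [pow_one, div_eq_inv_mul]
    gcongr
    exact h1 _
  have e2 : ‖iteratedFDeriv ℝ 2 (fun x : EuclideanSpace ℝ (Fin 3) => χ (R⁻¹ • x) - 1) x‖ ≤ b / R ^ 2 := by
    rw [hsub 2 (by norm_num) le_rfl]
    refine (norm_iteratedFDeriv_comp_smul_le hχ hR le_rfl x).trans ?_
    rw [inv_pow, div_eq_inv_mul]
    gcongr
    exact h2 _
  have hb : 0 ≤ b / R := le_trans (norm_nonneg _) e1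
  calc ‖χ (R⁻¹ • x) - 1‖ * ‖iteratedFDeriv ℝ 2 g x‖ +
        2 * ‖iteratedFDeriv ℝ 1 (fun x : EuclideanSpace ℝ (Fin 3) => χ (R⁻¹ • x) - 1) x‖ * ‖iteratedFDeriv ℝ 1 g x‖ +
        ‖iteratedFDeriv ℝ 2 (fun x : EuclideanSpace ℝ (Fin 3) => χ (R⁻¹ • x) - 1) x‖ * ‖g x‖
      ≤ 1 * ‖iteratedFDeriv ℝ 2 g x‖ + 2 * (b / R) * ‖iteratedFDeriv ℝ 1 g x‖ + b / R ^ 2 * ‖g x‖ := by gcongr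
    _ = ‖iteratedFDeriv ℝ 2 g x‖ + 2 * (b / R) * ‖iteratedFDeriv ℝ 1 g x‖ + b / R ^ 2 * ‖g x‖ := by rw [one_mul]

end CutoffTerm

/-! ## The truncation error bounds -/

section ErrorBounds

variable {V : EuclideanSpace ℝ (Fin 3) → EuclideanSpace ℝ (Fin 3)} {R : ℝ}

/-- Beyond radius `2R` the truncation vanishes near `x`. [folklore] -/
theorem solenoidalTruncation_eventuallyEq_zero (hR : 0 < R) {x : EuclideanSpace ℝ (Fin 3)} (hx : 2 * R < ‖x‖) :
    solenoidalTruncation V R =ᶠ[𝓝 x] fun _ => (0 : EuclideanSpace ℝ (Fin 3)) := by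
  have hopen : IsOpen {y : EuclideanSpace ℝ (Fin 3) | 2 * R < ‖y‖} := isOpen_lt continuous_const continuous_norm
  filter_upwards [hopen.mem_nhds hx] with y hy
  exact solenoidalTruncation_eq_zero hR hy

/-- The truncation error as a sum of two scaled-profile terms:
`Ψ_R − V = (χ(·/R) − 1)·V + Φ(·/R)[F]`. [folklore] -/
theorem solenoidalTruncation_sub_eq_profile (V : EuclideanSpace ℝ (Fin 3) → EuclideanSpace ℝ (Fin 3)) (R : ℝ) :
    (fun x => solenoidalTruncation V R x - V x) = fun x =>
      ((FunctionSpaces.dyadicCutoff (EuclideanSpace ℝ (Fin 3)) : EuclideanSpace ℝ (Fin 3) → ℝ) (R⁻¹ • x) - 1) • V x +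
        ((fderiv ℝ (FunctionSpaces.dyadicCutoff (EuclideanSpace ℝ (Fin 3)) : EuclideanSpace ℝ (Fin 3) → ℝ) (R⁻¹ • x)
              (R⁻¹ • x)) • ContinuousLinearMap.id ℝ (EuclideanSpace ℝ (Fin 3)) -
          (fderiv ℝ (FunctionSpaces.dyadicCutoff (EuclideanSpace ℝ (Fin 3)) : EuclideanSpace ℝ (Fin 3) → ℝ)
              (R⁻¹ • x)).smulRight (R⁻¹ • x))
          (poincareField V x) := by
  rw [solenoidalTruncation_eq_profile V R]
  funext x
  simp only [sub_smul, one_smul]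
  abel

/-- **The error bounds of orders 0, 1, 2 with annulus indicators.**  There is `K ≥ 0`, depending only on the
cut-off profile, such that for every `C^∞` field `V`, every `R ≥ 1` and every `x` (`A_R = {R ≤ ‖x‖ ≤ 2R}`,
`F = poincareField V`, `Dⁿ = iteratedFDeriv ℝ n`):
* `‖Ψ_R(x) − χ_R(x)V(x)‖ ≤ K·𝟙_{A_R}(x)‖F(x)‖`;
* `‖D¹(Ψ_R − V)(x)‖ ≤ 𝟙_{R≤‖x‖}‖D¹V(x)‖ + 𝟙_{A_R}(x)·K·(R⁻¹‖V(x)‖ + ‖D¹F(x)‖ + R⁻¹‖F(x)‖)`;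
* `‖D²(Ψ_R − V)(x)‖ ≤ 𝟙_{R≤‖x‖}‖D²V(x)‖ + 𝟙_{A_R}(x)·K·(‖D¹V(x)‖ + R⁻¹‖V(x)‖ + ‖D²F(x)‖ + ‖D¹F(x)‖ + R⁻¹‖F(x)‖)`.
Inside `B(0,R)` the error vanishes identically, outside `B̄(0,2R)` it is `−V`, and on the annulus the Leibniz
bounds of the two scaled-profile terms apply. [folklore] -/
theorem exists_truncation_error_bounds :
    ∃ K : ℝ, 0 ≤ K ∧ ∀ (V : EuclideanSpace ℝ (Fin 3) → EuclideanSpace ℝ (Fin 3)), ContDiff ℝ (⊤ : ℕ∞) V →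
      ∀ R : ℝ, 1 ≤ R → ∀ x : EuclideanSpace ℝ (Fin 3),
        ‖solenoidalTruncation V R x - cutoff R x • V x‖ ≤
            K * {x : EuclideanSpace ℝ (Fin 3) | R ≤ ‖x‖ ∧ ‖x‖ ≤ 2 * R}.indicator (fun x => ‖poincareField V x‖) x ∧
        ‖iteratedFDeriv ℝ 1 (fun x => solenoidalTruncation V R x - V x) x‖ ≤
            {x : EuclideanSpace ℝ (Fin 3) | R ≤ ‖x‖}.indicator (fun x => ‖iteratedFDeriv ℝ 1 V x‖) x +
              {x : EuclideanSpace ℝ (Fin 3) | R ≤ ‖x‖ ∧ ‖x‖ ≤ 2 * R}.indicator (fun x =>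
                K * (R⁻¹ * ‖V x‖ + ‖iteratedFDeriv ℝ 1 (poincareField V) x‖ + R⁻¹ * ‖poincareField V x‖)) x ∧
        ‖iteratedFDeriv ℝ 2 (fun x => solenoidalTruncation V R x - V x) x‖ ≤
            {x : EuclideanSpace ℝ (Fin 3) | R ≤ ‖x‖}.indicator (fun x => ‖iteratedFDeriv ℝ 2 V x‖) x +
              {x : EuclideanSpace ℝ (Fin 3) | R ≤ ‖x‖ ∧ ‖x‖ ≤ 2 * R}.indicator (fun x =>
                K * (‖iteratedFDeriv ℝ 1 V x‖ + R⁻¹ * ‖V x‖ + ‖iteratedFDeriv ℝ 2 (poincareField V) x‖ +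
                  ‖iteratedFDeriv ℝ 1 (poincareField V) x‖ + R⁻¹ * ‖poincareField V x‖)) x := by
  -- the profiles
  set χ : EuclideanSpace ℝ (Fin 3) → ℝ := ⇑(FunctionSpaces.dyadicCutoff (EuclideanSpace ℝ (Fin 3))) with hχdef
  set Φ : EuclideanSpace ℝ (Fin 3) → (EuclideanSpace ℝ (Fin 3) →L[ℝ] EuclideanSpace ℝ (Fin 3)) := fun y =>
    (fderiv ℝ χ y y) • ContinuousLinearMap.id ℝ (EuclideanSpace ℝ (Fin 3)) - (fderiv ℝ χ y).smulRight y with hΦdef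
  have hχs : ContDiff ℝ (⊤ : ℕ∞) χ := (FunctionSpaces.dyadicCutoff (EuclideanSpace ℝ (Fin 3))).contDiff
  have hχ2 : ContDiff ℝ 2 χ := contDiff_infty.1 hχs 2
  have hχc : HasCompactSupport χ := (FunctionSpaces.dyadicCutoff (EuclideanSpace ℝ (Fin 3))).hasCompactSupport
  have hχ3 : ContDiff ℝ 3 χ := contDiff_infty.1 hχs 3
  have hDχ : ContDiff ℝ 2 (fderiv ℝ χ) := hχ3.fderiv_right (by norm_num)
  have hΦ2 : ContDiff ℝ 2 Φ :=
    ((hDχ.clm_apply contDiff_id).smul contDiff_const).sub (hDχ.smulRight contDiff_id)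
  -- `Dχ` vanishes off the closed ball of radius `2`, hence so does `Φ`
  have hDχ0 : ∀ y : EuclideanSpace ℝ (Fin 3), 2 < ‖y‖ → fderiv ℝ χ y = 0 := by
    intro y hy
    have hopen : IsOpen {z : EuclideanSpace ℝ (Fin 3) | 2 < ‖z‖} := isOpen_lt continuous_const continuous_norm
    have hev : χ =ᶠ[𝓝 y] fun _ => (0 : ℝ) := by
      filter_upwards [hopen.mem_nhds hy] with z hz
      exact FunctionSpaces.dyadicCutoff_apply_of_two_le_norm hz.le
    rw [hev.fderiv_eq, fderiv_const_apply]
  have hΦc : HasCompactSupport Φ := by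
    refine HasCompactSupport.intro (isCompact_closedBall (0 : EuclideanSpace ℝ (Fin 3)) 2) fun y hy => ?_
    rw [mem_closedBall_zero_iff, not_le] at hy
    simp only [hΦdef, hDχ0 y hy, zero_apply, ContinuousLinearMap.zero_smulRight, sub_zero]
    ext v
    simp
  obtain ⟨a, ha0, ha, ha1, ha2⟩ := exists_bounds_of_hasCompactSupport hΦ2 hΦc
  obtain ⟨b, hb0, -, hb1, hb2⟩ := exists_bounds_of_hasCompactSupport hχ2 hχc
  have hχ01 : ∀ y, |χ y - 1| ≤ 1 := fun y => by
    have h0 := (FunctionSpaces.dyadicCutoff (EuclideanSpace ℝ (Fin 3))).nonneg (x := y)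
    have h1 := (FunctionSpaces.dyadicCutoff (EuclideanSpace ℝ (Fin 3))).le_one (x := y)
    rw [abs_le]; constructor <;> linarith
  -- the constant
  refine ⟨2 * max a b, by positivity, fun V hV R hR x => ?_⟩
  have hR0 : 0 < R := one_pos.trans_le hR
  have hV2 : ContDiff ℝ 2 V := contDiff_infty.1 hV 2
  have hF : ContDiff ℝ (⊤ : ℕ∞) (poincareField V) := contDiff_poincareField hV
  have hF2 : ContDiff ℝ 2 (poincareField V) := contDiff_infty.1 hF 2
  set F := poincareField V with hFdef
  set A := {x : EuclideanSpace ℝ (Fin 3) | R ≤ ‖x‖ ∧ ‖x‖ ≤ 2 * R} with hAdef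
  set e : EuclideanSpace ℝ (Fin 3) → EuclideanSpace ℝ (Fin 3) := fun x => solenoidalTruncation V R x - V x with hedef
  have hK : max a b ≤ 2 * max a b := by linarith [le_max_left a b]
  have haK : a ≤ 2 * max a b := (le_max_left a b).trans hK
  have hbK : b ≤ 2 * max a b := (le_max_right a b).trans hK
  -- nonnegativity of the indicator terms
  have hind1 : ∀ (f : EuclideanSpace ℝ (Fin 3) → ℝ), (∀ y, 0 ≤ f y) → ∀ (s : Set (EuclideanSpace ℝ (Fin 3))),
      0 ≤ s.indicator f x := fun f hf s => Set.indicator_nonneg (fun y _ => hf y) x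
  -- the three regions
  rcases lt_or_ge ‖x‖ R with hxR | hxR
  · -- inside the ball: no error at all
    have hev : e =ᶠ[𝓝 x] fun _ => (0 : EuclideanSpace ℝ (Fin 3)) := by
      filter_upwards [solenoidalTruncation_eventuallyEq (V := V) hR0 hxR] with y hy
      simp [hedef, hy]
    have hzero : ∀ n : ℕ, iteratedFDeriv ℝ n e x = 0 := fun n => by
      rw [iteratedFDeriv_eq_of_eventuallyEq hev n, iteratedFDeriv_fun_zero]; rfl
    have hpt : solenoidalTruncation V R x - cutoff R x • V x = 0 := by
      rw [(solenoidalTruncation_eventuallyEq (V := V) hR0 hxR).eq_of_nhds, cutoff_eq_one hR0 hxR.le, one_smul, sub_self]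
    refine ⟨?_, ?_, ?_⟩
    · rw [hpt, norm_zero]
      exact mul_nonneg (by positivity) (hind1 _ (fun y => norm_nonneg _) _)
    · rw [hzero 1, norm_zero]
      exact add_nonneg (hind1 _ (fun y => norm_nonneg _) _) (hind1 _ (fun y => by positivity) _)
    · rw [hzero 2, norm_zero]
      exact add_nonneg (hind1 _ (fun y => norm_nonneg _) _) (hind1 _ (fun y => by positivity) _)
  have hxmem : x ∈ {x : EuclideanSpace ℝ (Fin 3) | R ≤ ‖x‖} := hxR
  rcases le_or_gt ‖x‖ (2 * R) with hx2 | hx2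
  swap
  · -- beyond `2R`: the error is `-V`
    have hev : e =ᶠ[𝓝 x] fun y => -V y := by
      filter_upwards [solenoidalTruncation_eventuallyEq_zero (V := V) hR0 hx2] with y hy
      simp [hedef, hy]
    have hneg : ∀ n : ℕ, ‖iteratedFDeriv ℝ n e x‖ = ‖iteratedFDeriv ℝ n V x‖ := fun n => by
      rw [iteratedFDeriv_eq_of_eventuallyEq hev n]
      have : (fun y => -V y) = -V := rfl
      rw [this, iteratedFDeriv_neg_apply, norm_neg]
    have hxA : x ∉ A := fun h => (not_lt.2 h.2) hx2
    have hpt : solenoidalTruncation V R x - cutoff R x • V x = 0 := by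
      rw [solenoidalTruncation_eq_zero hR0 hx2, cutoff_eq_zero hR0 hx2.le, zero_smul, sub_zero]
    refine ⟨?_, ?_, ?_⟩
    · rw [hpt, norm_zero]
      exact mul_nonneg (by positivity) (hind1 _ (fun y => norm_nonneg _) _)
    · rw [hneg 1, indicator_of_mem hxmem, indicator_of_notMem hxA, add_zero]
    · rw [hneg 2, indicator_of_mem hxmem, indicator_of_notMem hxA, add_zero]
  -- the annulus
  have hxA : x ∈ A := ⟨hxR, hx2⟩
  rw [indicator_of_mem hxA, indicator_of_mem hxmem, indicator_of_mem hxA, indicator_of_mem hxmem,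
    indicator_of_mem hxA]
  -- the two terms of the error
  set T1 : EuclideanSpace ℝ (Fin 3) → EuclideanSpace ℝ (Fin 3) := fun x => (χ (R⁻¹ • x) - 1) • V x with hT1
  set T2 : EuclideanSpace ℝ (Fin 3) → EuclideanSpace ℝ (Fin 3) := fun x => Φ (R⁻¹ • x) (F x) with hT2
  have he : e = fun x => T1 x + T2 x := by
    rw [hedef, solenoidalTruncation_sub_eq_profile V R]
  have hT1s : ContDiff ℝ 2 T1 := ((hχ2.comp (contDiff_const_smul _)).sub contDiff_const).smul hV2
  have hT2s : ContDiff ℝ 2 T2 := (hΦ2.comp (contDiff_const_smul _)).clm_apply hF2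
  have hsplit : ∀ n : ℕ, n ≤ 2 → ‖iteratedFDeriv ℝ n e x‖ ≤ ‖iteratedFDeriv ℝ n T1 x‖ + ‖iteratedFDeriv ℝ n T2 x‖ := by
    intro n hn
    rw [he]
    have : (fun x => T1 x + T2 x) = T1 + T2 := rfl
    rw [this, iteratedFDeriv_add_apply ((hT1s.of_le (by exact_mod_cast hn)).contDiffAt)
      ((hT2s.of_le (by exact_mod_cast hn)).contDiffAt)]
    exact norm_add_le _ _
  -- order zero
  have h0 : ‖solenoidalTruncation V R x - cutoff R x • V x‖ ≤ 2 * max a b * ‖F x‖ := by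
    have hrep := congrFun (solenoidalTruncation_eq_profile V R) x
    have hχR : cutoff (E := EuclideanSpace ℝ (Fin 3)) R x = χ (R⁻¹ • x) := rfl
    rw [hrep, hχR, add_sub_cancel_left]
    calc ‖Φ (R⁻¹ • x) (F x)‖ ≤ ‖Φ (R⁻¹ • x)‖ * ‖F x‖ := ContinuousLinearMap.le_opNorm _ _
      _ ≤ 2 * max a b * ‖F x‖ := by gcongr; exact (ha _).trans haK
  refine ⟨h0, ?_, ?_⟩
  · -- order one
    have b1 := norm_iteratedFDeriv_cutoffSub_smul_le_one (hχ2.of_le (by norm_num)) hχ01 hb1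
      (hV2.of_le (by norm_num)) hR0 x
    have b2 := norm_iteratedFDeriv_scaledProfile_apply_le_one (hΦ2.of_le (by norm_num)) ha ha1
      (g := F) (hF2.of_le (by norm_num)) hR0 x
    refine (hsplit 1 (by norm_num)).trans ?_
    refine (add_le_add b1 b2).trans ?_
    have e1 : b / R * ‖V x‖ ≤ 2 * max a b * (R⁻¹ * ‖V x‖) := by
      rw [div_eq_mul_inv, mul_assoc]; gcongr
    have e2 : a * ‖iteratedFDeriv ℝ 1 F x‖ ≤ 2 * max a b * ‖iteratedFDeriv ℝ 1 F x‖ := by gcongr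
    have e3 : a / R * ‖F x‖ ≤ 2 * max a b * (R⁻¹ * ‖F x‖) := by
      rw [div_eq_mul_inv, mul_assoc]; gcongr
    linarith
  · -- order two
    have b1 := norm_iteratedFDeriv_cutoffSub_smul_le_two hχ2 hχ01 hb1 hb2 hV2 hR0 x
    have b2 := norm_iteratedFDeriv_scaledProfile_apply_le_two hΦ2 ha ha1 ha2 (g := F) hF2 hR0 x
    refine (hsplit 2 le_rfl).trans ?_
    refine (add_le_add b1 b2).trans ?_
    have hR1 : R⁻¹ ≤ 1 := inv_le_one_of_one_le₀ hR
    have hRinv : 0 ≤ R⁻¹ := inv_nonneg.2 hR0.le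
    have hR2 : (R ^ 2)⁻¹ ≤ R⁻¹ := by
      rw [pow_two, mul_inv]
      calc R⁻¹ * R⁻¹ ≤ R⁻¹ * 1 := by gcongr
        _ = R⁻¹ := mul_one _
    have e1 : 2 * (b / R) * ‖iteratedFDeriv ℝ 1 V x‖ ≤ 2 * max a b * ‖iteratedFDeriv ℝ 1 V x‖ := by
      rw [div_eq_mul_inv]
      have : b * R⁻¹ ≤ max a b := by
        calc b * R⁻¹ ≤ b * 1 := by gcongr
          _ = b := mul_one b
          _ ≤ max a b := le_max_right a b
      gcongr
    have e2 : b / R ^ 2 * ‖V x‖ ≤ 2 * max a b * (R⁻¹ * ‖V x‖) := by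
      rw [div_eq_mul_inv]
      calc b * (R ^ 2)⁻¹ * ‖V x‖ ≤ (2 * max a b) * R⁻¹ * ‖V x‖ := by gcongr
        _ = 2 * max a b * (R⁻¹ * ‖V x‖) := by ring
    have e3 : a * ‖iteratedFDeriv ℝ 2 F x‖ ≤ 2 * max a b * ‖iteratedFDeriv ℝ 2 F x‖ := by gcongr
    have e4 : 2 * (a / R) * ‖iteratedFDeriv ℝ 1 F x‖ ≤ 2 * max a b * ‖iteratedFDeriv ℝ 1 F x‖ := by
      rw [div_eq_mul_inv]
      have : a * R⁻¹ ≤ max a b := by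
        calc a * R⁻¹ ≤ a * 1 := by gcongr
          _ = a := mul_one a
          _ ≤ max a b := le_max_left a b
      gcongr
    have e5 : a / R ^ 2 * ‖F x‖ ≤ 2 * max a b * (R⁻¹ * ‖F x‖) := by
      rw [div_eq_mul_inv]
      calc a * (R ^ 2)⁻¹ * ‖F x‖ ≤ (2 * max a b) * R⁻¹ * ‖F x‖ := by gcongr
        _ = 2 * max a b * (R⁻¹ * ‖F x‖) := by ring
    linarith

end ErrorBounds

end ExtremiserLiouville


end Summit.NavierStokesRegularity.NavierStokesRegularity.Theorems

end
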